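/-
Copyright (c) 2026. All rights reserved.
Released under Apache 2.0 license as described in the file LICENSE.
-/
import Literature.Probability.FitznerVanDerHofstad2017.SrwTrigMajorantEncl
import Literature.Probability.FitznerVanDerHofstad2017.SrwTwistClassEncl
import Literature.Probability.FitznerVanDerHofstad2017.SrwTwistClassMass
import HarnessLib

/-!
# The `K_{n,2}`, `U_{n,0}`, `U_{n,2}`, `KM₂` rows from PURE-CLASS enclosures and plain-seed tables

Support module (d-generic, number-free, definition-free): the last d-generic bookkeeping layer of the
KU-SEP twisted-seed chain.  It composes

* the trigonometric-majorant rows over enclosed inputs (`SrwTrigMajorantEncl`: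
  `srwK_le_gset_encl_cast`, `srwU_le_gset_encl_cast`, `srwKM2_le_gset_encl_cast` — literal coefficients
  `MajCert.gset`, abscissae `gsetB r ∈ {5,10,15,20,25,30}`),
* the pure-class enclosures of the row moments (`SrwTwistClassEncl`), and
* the class masses at `β = 0` as plain seeds (`SrwTwistClassMass`),

into ONE theorem per weighted cell type whose hypotheses are exactly what the instance layer produces:
rational enclosures of the pure cosine-product class moments `Tw^{Π cos^{a}}_m(x; gsetB r)` (product-kernel
certificates), rational enclosures of the plain seeds `I_{m,0}(x₀)` at the small class nodes (seed tables),
and a rational bound `Shi` on the `Sq`-moment of the row weight: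

* `srwK_two_le_gset_classEncl_cast` (`K_{n,2}`: classes `[2]`, `[1,1]`),
* `srwU_zero_le_gset_classEncl_cast` (`U_{n,0}`: classes `[0]`, `[2]`),
* `srwU_two_le_gset_classEncl_cast` (`U_{n,2}`: classes `[2],[4],[1,1],[2,2],[3,1],[1,1,2]`),
* `srwKM2_zero_le_gset_classEncl_cast` (`KM₂`, `l = 0`: classes `[2]ₙ,[1,1]ₙ,[1]ₙ₊₁,[3]ₙ₊₁,[1,2]ₙ₊₁,
  [0]ₙ₊₂,[2]ₙ₊₂,[4]ₙ₊₂,[2,2]ₙ₊₂`),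

each concluding `cell ≤ ((rational expression : ℚ) : ℝ)`, so that a cell inequality against a rational budget
is closed by `decide`/`norm_num` once the instance rows are named; and the class masses at `β = 0` as
ENCLOSURES from seed enclosures (`srwTwist_*_zero_encl`, real and `ℚ`-cast forms) feeding the `T`-inputs;
and the assembler `encl_forall_gsetB` of the `∀ r`-hypotheses from six enclosures at the literal abscissae
`β = 5, 10, 15, 20, 25, 30` (`gsetB_eq`).

All statements are exact bookkeeping for general `d`; nothing here is numerical and nothing is a
certificate.  No dimension-specific declaration is introduced.

References: [FvdH17] R. Fitzner, R. van der Hofstad, *Mean-field behavior for nearest-neighbor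
percolation in `d > 10`*, Electron. J. Probab. 22 (2017) no. 43 and the NoBLE companion PTRF 169 (2017)
1041–1119, (3.34)–(3.38) p. 1071, §5.1.2 (5.11)–(5.16) pp. 1091–1092, §5.2 (5.9), (5.14) p. 1092.
-/

noncomputable section

open MeasureTheory Real Finset
open scoped BigOperators

namespace Literature.Probability.FitznerVanDerHofstad2017

open TrigEncl
open Literature.Barriers.CriticalPhenomena
open Literature.Barriers.CriticalPhenomena.Slade2006Prop53 (P)

variable {d : ℕ}

/-! ### Class masses at `β = 0` as enclosures from plain-seed enclosures -/
/-- Class mass `[0]`: `Tw^{1}_n(x;0) = I_{n,0}(0)` as an ENCLOSURE from seed enclosures (`β = 0`).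
[cite: FitznerVanDerHofstad2016NoBLE, (3.34)–(3.35) p. 1071, §5.2 (5.9) p. 1092] -/
theorem srwTwist_one_zero_encl (n : ℕ) (x : Fin d → ℤ) {z₀ Z₀ : ℝ}
    (h0 : z₀ ≤ srwI d n 0 0 ∧ srwI d n 0 0 ≤ Z₀) :
    z₀ ≤ srwTwist d n (fun _ => (1 : ℝ)) x 0
      ∧ srwTwist d n (fun _ => (1 : ℝ)) x 0 ≤ Z₀ := by
  rw [srwTwist_one_zero_eq_srwI n x]
  constructor <;> linarith [h0.1, h0.2]

/-- Class mass `[0]`: `Tw^{1}_n(x;0) = I_{n,0}(0)` as an enclosure from RATIONAL seed enclosures (`β = 0`, `ℚ`-cast form).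
[cite: FitznerVanDerHofstad2016NoBLE, (3.34)–(3.35) p. 1071, §5.2 (5.9) p. 1092] -/
theorem srwTwist_one_zero_encl_cast (n : ℕ) (x : Fin d → ℤ) {z₀ Z₀ : ℚ}
    (h0 : (z₀ : ℝ) ≤ srwI d n 0 0 ∧ srwI d n 0 0 ≤ (Z₀ : ℝ)) :
    ((z₀ : ℚ) : ℝ) ≤ srwTwist d n (fun _ => (1 : ℝ)) x 0
      ∧ srwTwist d n (fun _ => (1 : ℝ)) x 0 ≤ ((Z₀ : ℚ) : ℝ) := by
  exact srwTwist_one_zero_encl n x h0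

/-- Class mass `[1]`: `Tw^{cos k_i}_n(x;0) = I_{n,0}(e_i)` as an ENCLOSURE from seed enclosures (`β = 0`).
[cite: FitznerVanDerHofstad2016NoBLE, (3.34)–(3.35) p. 1071, §5.2 (5.9) p. 1092] -/
theorem srwTwist_cos_zero_encl {n : ℕ} (hd : 2 * n + 1 ≤ d) (i : Fin d) (x : Fin d → ℤ) {z₁ Z₁ : ℝ}
    (h1 : z₁ ≤ srwI d n 0 (Pi.single i 1) ∧ srwI d n 0 (Pi.single i 1) ≤ Z₁) :
    z₁ ≤ srwTwist d n (fun k => Real.cos (k i)) x 0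
      ∧ srwTwist d n (fun k => Real.cos (k i)) x 0 ≤ Z₁ := by
  rw [srwTwist_cos_zero_eq_srwI hd i x]
  constructor <;> linarith [h1.1, h1.2]

/-- Class mass `[1]`: `Tw^{cos k_i}_n(x;0) = I_{n,0}(e_i)` as an enclosure from RATIONAL seed enclosures (`β = 0`, `ℚ`-cast form).
[cite: FitznerVanDerHofstad2016NoBLE, (3.34)–(3.35) p. 1071, §5.2 (5.9) p. 1092] -/
theorem srwTwist_cos_zero_encl_cast {n : ℕ} (hd : 2 * n + 1 ≤ d) (i : Fin d) (x : Fin d → ℤ) {z₁ Z₁ : ℚ}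
    (h1 : (z₁ : ℝ) ≤ srwI d n 0 (Pi.single i 1) ∧ srwI d n 0 (Pi.single i 1) ≤ (Z₁ : ℝ)) :
    ((z₁ : ℚ) : ℝ) ≤ srwTwist d n (fun k => Real.cos (k i)) x 0
      ∧ srwTwist d n (fun k => Real.cos (k i)) x 0 ≤ ((Z₁ : ℚ) : ℝ) := by
  exact srwTwist_cos_zero_encl hd i x h1

/-- Class mass `[2]`: `(I(0) + I(2e_i))/2` as an ENCLOSURE from seed enclosures (`β = 0`).
[cite: FitznerVanDerHofstad2016NoBLE, (3.34)–(3.35) p. 1071, §5.2 (5.9) p. 1092] -/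
theorem srwTwist_cos_sq_zero_encl {n : ℕ} (hd : 2 * n + 1 ≤ d) (i : Fin d) (x : Fin d → ℤ) {z₀ Z₀ z₂ Z₂ : ℝ}
    (h0 : z₀ ≤ srwI d n 0 0 ∧ srwI d n 0 0 ≤ Z₀)
    (h2 : z₂ ≤ srwI d n 0 (Pi.single i 2) ∧ srwI d n 0 (Pi.single i 2) ≤ Z₂) :
    (z₀ + z₂) / 2 ≤ srwTwist d n (fun k => Real.cos (k i) ^ 2) x 0
      ∧ srwTwist d n (fun k => Real.cos (k i) ^ 2) x 0 ≤ (Z₀ + Z₂) / 2 := by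
  rw [srwTwist_cos_sq_zero_eq hd i x]
  constructor <;> linarith [h0.1, h0.2, h2.1, h2.2]

/-- Class mass `[2]`: `(I(0) + I(2e_i))/2` as an enclosure from RATIONAL seed enclosures (`β = 0`, `ℚ`-cast form).
[cite: FitznerVanDerHofstad2016NoBLE, (3.34)–(3.35) p. 1071, §5.2 (5.9) p. 1092] -/
theorem srwTwist_cos_sq_zero_encl_cast {n : ℕ} (hd : 2 * n + 1 ≤ d) (i : Fin d) (x : Fin d → ℤ) {z₀ Z₀ z₂ Z₂ : ℚ}
    (h0 : (z₀ : ℝ) ≤ srwI d n 0 0 ∧ srwI d n 0 0 ≤ (Z₀ : ℝ))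
    (h2 : (z₂ : ℝ) ≤ srwI d n 0 (Pi.single i 2) ∧ srwI d n 0 (Pi.single i 2) ≤ (Z₂ : ℝ)) :
    (((z₀ + z₂) / 2 : ℚ) : ℝ) ≤ srwTwist d n (fun k => Real.cos (k i) ^ 2) x 0
      ∧ srwTwist d n (fun k => Real.cos (k i) ^ 2) x 0 ≤ (((Z₀ + Z₂) / 2 : ℚ) : ℝ) := by
  push_cast
  exact srwTwist_cos_sq_zero_encl hd i x h0 h2

/-- Class mass `[3]`: `(3I(e_i) + I(3e_i))/4` as an ENCLOSURE from seed enclosures (`β = 0`).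
[cite: FitznerVanDerHofstad2016NoBLE, (3.34)–(3.35) p. 1071, §5.2 (5.9) p. 1092] -/
theorem srwTwist_cos_pow_three_zero_encl {n : ℕ} (hd : 2 * n + 1 ≤ d) (i : Fin d) (x : Fin d → ℤ) {z₁ Z₁ z₃ Z₃ : ℝ}
    (h1 : z₁ ≤ srwI d n 0 (Pi.single i 1) ∧ srwI d n 0 (Pi.single i 1) ≤ Z₁)
    (h3 : z₃ ≤ srwI d n 0 (Pi.single i 3) ∧ srwI d n 0 (Pi.single i 3) ≤ Z₃) :
    (3 * z₁ + z₃) / 4 ≤ srwTwist d n (fun k => Real.cos (k i) ^ 3) x 0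
      ∧ srwTwist d n (fun k => Real.cos (k i) ^ 3) x 0 ≤ (3 * Z₁ + Z₃) / 4 := by
  rw [srwTwist_cos_pow_three_zero_eq hd i x]
  constructor <;> linarith [h1.1, h1.2, h3.1, h3.2]

/-- Class mass `[3]`: `(3I(e_i) + I(3e_i))/4` as an enclosure from RATIONAL seed enclosures (`β = 0`, `ℚ`-cast form).
[cite: FitznerVanDerHofstad2016NoBLE, (3.34)–(3.35) p. 1071, §5.2 (5.9) p. 1092] -/
theorem srwTwist_cos_pow_three_zero_encl_cast {n : ℕ} (hd : 2 * n + 1 ≤ d) (i : Fin d) (x : Fin d → ℤ) {z₁ Z₁ z₃ Z₃ : ℚ}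
    (h1 : (z₁ : ℝ) ≤ srwI d n 0 (Pi.single i 1) ∧ srwI d n 0 (Pi.single i 1) ≤ (Z₁ : ℝ))
    (h3 : (z₃ : ℝ) ≤ srwI d n 0 (Pi.single i 3) ∧ srwI d n 0 (Pi.single i 3) ≤ (Z₃ : ℝ)) :
    (((3 * z₁ + z₃) / 4 : ℚ) : ℝ) ≤ srwTwist d n (fun k => Real.cos (k i) ^ 3) x 0
      ∧ srwTwist d n (fun k => Real.cos (k i) ^ 3) x 0 ≤ (((3 * Z₁ + Z₃) / 4 : ℚ) : ℝ) := by
  push_cast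
  exact srwTwist_cos_pow_three_zero_encl hd i x h1 h3

/-- Class mass `[4]`: `(3I(0) + 4I(2e_i) + I(4e_i))/8` as an ENCLOSURE from seed enclosures (`β = 0`).
[cite: FitznerVanDerHofstad2016NoBLE, (3.34)–(3.35) p. 1071, §5.2 (5.9) p. 1092] -/
theorem srwTwist_cos_pow_four_zero_encl {n : ℕ} (hd : 2 * n + 1 ≤ d) (i : Fin d) (x : Fin d → ℤ) {z₀ Z₀ z₂ Z₂ z₄ Z₄ : ℝ}
    (h0 : z₀ ≤ srwI d n 0 0 ∧ srwI d n 0 0 ≤ Z₀)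
    (h2 : z₂ ≤ srwI d n 0 (Pi.single i 2) ∧ srwI d n 0 (Pi.single i 2) ≤ Z₂)
    (h4 : z₄ ≤ srwI d n 0 (Pi.single i 4) ∧ srwI d n 0 (Pi.single i 4) ≤ Z₄) :
    (3 * z₀ + 4 * z₂ + z₄) / 8 ≤ srwTwist d n (fun k => Real.cos (k i) ^ 4) x 0
      ∧ srwTwist d n (fun k => Real.cos (k i) ^ 4) x 0 ≤ (3 * Z₀ + 4 * Z₂ + Z₄) / 8 := by
  rw [srwTwist_cos_pow_four_zero_eq hd i x]
  constructor <;> linarith [h0.1, h0.2, h2.1, h2.2, h4.1, h4.2]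

/-- Class mass `[4]`: `(3I(0) + 4I(2e_i) + I(4e_i))/8` as an enclosure from RATIONAL seed enclosures (`β = 0`, `ℚ`-cast form).
[cite: FitznerVanDerHofstad2016NoBLE, (3.34)–(3.35) p. 1071, §5.2 (5.9) p. 1092] -/
theorem srwTwist_cos_pow_four_zero_encl_cast {n : ℕ} (hd : 2 * n + 1 ≤ d) (i : Fin d) (x : Fin d → ℤ) {z₀ Z₀ z₂ Z₂ z₄ Z₄ : ℚ}
    (h0 : (z₀ : ℝ) ≤ srwI d n 0 0 ∧ srwI d n 0 0 ≤ (Z₀ : ℝ))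
    (h2 : (z₂ : ℝ) ≤ srwI d n 0 (Pi.single i 2) ∧ srwI d n 0 (Pi.single i 2) ≤ (Z₂ : ℝ))
    (h4 : (z₄ : ℝ) ≤ srwI d n 0 (Pi.single i 4) ∧ srwI d n 0 (Pi.single i 4) ≤ (Z₄ : ℝ)) :
    (((3 * z₀ + 4 * z₂ + z₄) / 8 : ℚ) : ℝ) ≤ srwTwist d n (fun k => Real.cos (k i) ^ 4) x 0
      ∧ srwTwist d n (fun k => Real.cos (k i) ^ 4) x 0 ≤ (((3 * Z₀ + 4 * Z₂ + Z₄) / 8 : ℚ) : ℝ) := by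
  push_cast
  exact srwTwist_cos_pow_four_zero_encl hd i x h0 h2 h4

/-- Class mass `[1,1]`: `I_{n,0}(e_i + e_{i'})` as an ENCLOSURE from seed enclosures (`β = 0`).
[cite: FitznerVanDerHofstad2016NoBLE, (3.34)–(3.35) p. 1071, §5.2 (5.9) p. 1092] -/
theorem srwTwist_cos_mul_cos_zero_encl {n : ℕ} (hd : 2 * n + 1 ≤ d) {i i' : Fin d} (hii' : i ≠ i') (x : Fin d → ℤ) {z₁₁ Z₁₁ : ℝ}
    (h11 : z₁₁ ≤ srwI d n 0 (Pi.single i 1 + Pi.single i' 1) ∧ srwI d n 0 (Pi.single i 1 + Pi.single i' 1) ≤ Z₁₁) :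
    z₁₁ ≤ srwTwist d n (fun k => Real.cos (k i) * Real.cos (k i')) x 0
      ∧ srwTwist d n (fun k => Real.cos (k i) * Real.cos (k i')) x 0 ≤ Z₁₁ := by
  rw [srwTwist_cos_mul_cos_zero_eq_srwI hd hii' x]
  constructor <;> linarith [h11.1, h11.2]

/-- Class mass `[1,1]`: `I_{n,0}(e_i + e_{i'})` as an enclosure from RATIONAL seed enclosures (`β = 0`, `ℚ`-cast form).
[cite: FitznerVanDerHofstad2016NoBLE, (3.34)–(3.35) p. 1071, §5.2 (5.9) p. 1092] -/
theorem srwTwist_cos_mul_cos_zero_encl_cast {n : ℕ} (hd : 2 * n + 1 ≤ d) {i i' : Fin d} (hii' : i ≠ i') (x : Fin d → ℤ) {z₁₁ Z₁₁ : ℚ}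
    (h11 : (z₁₁ : ℝ) ≤ srwI d n 0 (Pi.single i 1 + Pi.single i' 1) ∧ srwI d n 0 (Pi.single i 1 + Pi.single i' 1) ≤ (Z₁₁ : ℝ)) :
    ((z₁₁ : ℚ) : ℝ) ≤ srwTwist d n (fun k => Real.cos (k i) * Real.cos (k i')) x 0
      ∧ srwTwist d n (fun k => Real.cos (k i) * Real.cos (k i')) x 0 ≤ ((Z₁₁ : ℚ) : ℝ) := by
  exact srwTwist_cos_mul_cos_zero_encl hd hii' x h11

/-- Class mass `[1,2]`: `(I(e_i) + I(e_i + 2e_{i'}))/2` as an ENCLOSURE from seed enclosures (`β = 0`).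
[cite: FitznerVanDerHofstad2016NoBLE, (3.34)–(3.35) p. 1071, §5.2 (5.9) p. 1092] -/
theorem srwTwist_cos_mul_cos_sq_zero_encl {n : ℕ} (hd : 2 * n + 1 ≤ d) {i i' : Fin d} (hii' : i ≠ i') (x : Fin d → ℤ) {z₁ Z₁ z₁₂ Z₁₂ : ℝ}
    (h1 : z₁ ≤ srwI d n 0 (Pi.single i 1) ∧ srwI d n 0 (Pi.single i 1) ≤ Z₁)
    (h12 : z₁₂ ≤ srwI d n 0 (Pi.single i 1 + Pi.single i' 2) ∧ srwI d n 0 (Pi.single i 1 + Pi.single i' 2) ≤ Z₁₂) :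
    (z₁ + z₁₂) / 2 ≤ srwTwist d n (fun k => Real.cos (k i) * Real.cos (k i') ^ 2) x 0
      ∧ srwTwist d n (fun k => Real.cos (k i) * Real.cos (k i') ^ 2) x 0 ≤ (Z₁ + Z₁₂) / 2 := by
  rw [srwTwist_cos_mul_cos_sq_zero_eq hd hii' x]
  constructor <;> linarith [h1.1, h1.2, h12.1, h12.2]

/-- Class mass `[1,2]`: `(I(e_i) + I(e_i + 2e_{i'}))/2` as an enclosure from RATIONAL seed enclosures (`β = 0`, `ℚ`-cast form).
[cite: FitznerVanDerHofstad2016NoBLE, (3.34)–(3.35) p. 1071, §5.2 (5.9) p. 1092] -/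
theorem srwTwist_cos_mul_cos_sq_zero_encl_cast {n : ℕ} (hd : 2 * n + 1 ≤ d) {i i' : Fin d} (hii' : i ≠ i') (x : Fin d → ℤ) {z₁ Z₁ z₁₂ Z₁₂ : ℚ}
    (h1 : (z₁ : ℝ) ≤ srwI d n 0 (Pi.single i 1) ∧ srwI d n 0 (Pi.single i 1) ≤ (Z₁ : ℝ))
    (h12 : (z₁₂ : ℝ) ≤ srwI d n 0 (Pi.single i 1 + Pi.single i' 2) ∧ srwI d n 0 (Pi.single i 1 + Pi.single i' 2) ≤ (Z₁₂ : ℝ)) :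
    (((z₁ + z₁₂) / 2 : ℚ) : ℝ) ≤ srwTwist d n (fun k => Real.cos (k i) * Real.cos (k i') ^ 2) x 0
      ∧ srwTwist d n (fun k => Real.cos (k i) * Real.cos (k i') ^ 2) x 0 ≤ (((Z₁ + Z₁₂) / 2 : ℚ) : ℝ) := by
  push_cast
  exact srwTwist_cos_mul_cos_sq_zero_encl hd hii' x h1 h12

/-- Class mass `[2,2]`: `(I(0) + I(2e_i) + I(2e_{i'}) + I(2e_i + 2e_{i'}))/4` as an ENCLOSURE from seed enclosures (`β = 0`).
[cite: FitznerVanDerHofstad2016NoBLE, (3.34)–(3.35) p. 1071, §5.2 (5.9) p. 1092] -/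
theorem srwTwist_cos_sq_mul_cos_sq_zero_encl {n : ℕ} (hd : 2 * n + 1 ≤ d) {i i' : Fin d} (hii' : i ≠ i') (x : Fin d → ℤ) {z₀ Z₀ z₂ Z₂ z₂' Z₂' z₂₂ Z₂₂ : ℝ}
    (h0 : z₀ ≤ srwI d n 0 0 ∧ srwI d n 0 0 ≤ Z₀)
    (h2 : z₂ ≤ srwI d n 0 (Pi.single i 2) ∧ srwI d n 0 (Pi.single i 2) ≤ Z₂)
    (h2' : z₂' ≤ srwI d n 0 (Pi.single i' 2) ∧ srwI d n 0 (Pi.single i' 2) ≤ Z₂')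
    (h22 : z₂₂ ≤ srwI d n 0 (Pi.single i 2 + Pi.single i' 2) ∧ srwI d n 0 (Pi.single i 2 + Pi.single i' 2) ≤ Z₂₂) :
    (z₀ + z₂ + z₂' + z₂₂) / 4 ≤ srwTwist d n (fun k => Real.cos (k i) ^ 2 * Real.cos (k i') ^ 2) x 0
      ∧ srwTwist d n (fun k => Real.cos (k i) ^ 2 * Real.cos (k i') ^ 2) x 0 ≤ (Z₀ + Z₂ + Z₂' + Z₂₂) / 4 := by
  rw [srwTwist_cos_sq_mul_cos_sq_zero_eq hd hii' x]
  constructor <;> linarith [h0.1, h0.2, h2.1, h2.2, h2'.1, h2'.2, h22.1, h22.2]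

/-- Class mass `[2,2]`: `(I(0) + I(2e_i) + I(2e_{i'}) + I(2e_i + 2e_{i'}))/4` as an enclosure from RATIONAL seed enclosures (`β = 0`, `ℚ`-cast form).
[cite: FitznerVanDerHofstad2016NoBLE, (3.34)–(3.35) p. 1071, §5.2 (5.9) p. 1092] -/
theorem srwTwist_cos_sq_mul_cos_sq_zero_encl_cast {n : ℕ} (hd : 2 * n + 1 ≤ d) {i i' : Fin d} (hii' : i ≠ i') (x : Fin d → ℤ) {z₀ Z₀ z₂ Z₂ z₂' Z₂' z₂₂ Z₂₂ : ℚ}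
    (h0 : (z₀ : ℝ) ≤ srwI d n 0 0 ∧ srwI d n 0 0 ≤ (Z₀ : ℝ))
    (h2 : (z₂ : ℝ) ≤ srwI d n 0 (Pi.single i 2) ∧ srwI d n 0 (Pi.single i 2) ≤ (Z₂ : ℝ))
    (h2' : (z₂' : ℝ) ≤ srwI d n 0 (Pi.single i' 2) ∧ srwI d n 0 (Pi.single i' 2) ≤ (Z₂' : ℝ))
    (h22 : (z₂₂ : ℝ) ≤ srwI d n 0 (Pi.single i 2 + Pi.single i' 2) ∧ srwI d n 0 (Pi.single i 2 + Pi.single i' 2) ≤ (Z₂₂ : ℝ)) :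
    (((z₀ + z₂ + z₂' + z₂₂) / 4 : ℚ) : ℝ) ≤ srwTwist d n (fun k => Real.cos (k i) ^ 2 * Real.cos (k i') ^ 2) x 0
      ∧ srwTwist d n (fun k => Real.cos (k i) ^ 2 * Real.cos (k i') ^ 2) x 0 ≤ (((Z₀ + Z₂ + Z₂' + Z₂₂) / 4 : ℚ) : ℝ) := by
  push_cast
  exact srwTwist_cos_sq_mul_cos_sq_zero_encl hd hii' x h0 h2 h2' h22

/-- Class mass `[3,1]`: `(3I(e_i + e_{i'}) + I(3e_i + e_{i'}))/4` as an ENCLOSURE from seed enclosures (`β = 0`).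
[cite: FitznerVanDerHofstad2016NoBLE, (3.34)–(3.35) p. 1071, §5.2 (5.9) p. 1092] -/
theorem srwTwist_cos_pow_three_mul_cos_zero_encl {n : ℕ} (hd : 2 * n + 1 ≤ d) {i i' : Fin d} (hii' : i ≠ i') (x : Fin d → ℤ) {z₁₁ Z₁₁ z₃₁ Z₃₁ : ℝ}
    (h11 : z₁₁ ≤ srwI d n 0 (Pi.single i 1 + Pi.single i' 1) ∧ srwI d n 0 (Pi.single i 1 + Pi.single i' 1) ≤ Z₁₁)
    (h31 : z₃₁ ≤ srwI d n 0 (Pi.single i 3 + Pi.single i' 1) ∧ srwI d n 0 (Pi.single i 3 + Pi.single i' 1) ≤ Z₃₁) :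
    (3 * z₁₁ + z₃₁) / 4 ≤ srwTwist d n (fun k => Real.cos (k i) ^ 3 * Real.cos (k i')) x 0
      ∧ srwTwist d n (fun k => Real.cos (k i) ^ 3 * Real.cos (k i')) x 0 ≤ (3 * Z₁₁ + Z₃₁) / 4 := by
  rw [srwTwist_cos_pow_three_mul_cos_zero_eq hd hii' x]
  constructor <;> linarith [h11.1, h11.2, h31.1, h31.2]

/-- Class mass `[3,1]`: `(3I(e_i + e_{i'}) + I(3e_i + e_{i'}))/4` as an enclosure from RATIONAL seed enclosures (`β = 0`, `ℚ`-cast form).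
[cite: FitznerVanDerHofstad2016NoBLE, (3.34)–(3.35) p. 1071, §5.2 (5.9) p. 1092] -/
theorem srwTwist_cos_pow_three_mul_cos_zero_encl_cast {n : ℕ} (hd : 2 * n + 1 ≤ d) {i i' : Fin d} (hii' : i ≠ i') (x : Fin d → ℤ) {z₁₁ Z₁₁ z₃₁ Z₃₁ : ℚ}
    (h11 : (z₁₁ : ℝ) ≤ srwI d n 0 (Pi.single i 1 + Pi.single i' 1) ∧ srwI d n 0 (Pi.single i 1 + Pi.single i' 1) ≤ (Z₁₁ : ℝ))
    (h31 : (z₃₁ : ℝ) ≤ srwI d n 0 (Pi.single i 3 + Pi.single i' 1) ∧ srwI d n 0 (Pi.single i 3 + Pi.single i' 1) ≤ (Z₃₁ : ℝ)) :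
    (((3 * z₁₁ + z₃₁) / 4 : ℚ) : ℝ) ≤ srwTwist d n (fun k => Real.cos (k i) ^ 3 * Real.cos (k i')) x 0
      ∧ srwTwist d n (fun k => Real.cos (k i) ^ 3 * Real.cos (k i')) x 0 ≤ (((3 * Z₁₁ + Z₃₁) / 4 : ℚ) : ℝ) := by
  push_cast
  exact srwTwist_cos_pow_three_mul_cos_zero_encl hd hii' x h11 h31

/-- Class mass `[1,1,2]`: `(I(e_i + e_{i'}) + I(e_i + e_{i'} + 2e_{i''}))/2` as an ENCLOSURE from seed enclosures (`β = 0`).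
[cite: FitznerVanDerHofstad2016NoBLE, (3.34)–(3.35) p. 1071, §5.2 (5.9) p. 1092] -/
theorem srwTwist_cos_mul_cos_mul_cos_sq_zero_encl {n : ℕ} (hd : 2 * n + 1 ≤ d) {i i' i'' : Fin d} (hii' : i ≠ i') (hii'' : i ≠ i'') (hi'i'' : i' ≠ i'') (x : Fin d → ℤ) {z₁₁ Z₁₁ z₁₁₂ Z₁₁₂ : ℝ}
    (h11 : z₁₁ ≤ srwI d n 0 (Pi.single i 1 + Pi.single i' 1) ∧ srwI d n 0 (Pi.single i 1 + Pi.single i' 1) ≤ Z₁₁)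
    (h112 : z₁₁₂ ≤ srwI d n 0 (Pi.single i 1 + Pi.single i' 1 + Pi.single i'' 2) ∧ srwI d n 0 (Pi.single i 1 + Pi.single i' 1 + Pi.single i'' 2) ≤ Z₁₁₂) :
    (z₁₁ + z₁₁₂) / 2 ≤ srwTwist d n (fun k => Real.cos (k i) * Real.cos (k i') * Real.cos (k i'') ^ 2) x 0
      ∧ srwTwist d n (fun k => Real.cos (k i) * Real.cos (k i') * Real.cos (k i'') ^ 2) x 0 ≤ (Z₁₁ + Z₁₁₂) / 2 := by
  rw [srwTwist_cos_mul_cos_mul_cos_sq_zero_eq hd hii' hii'' hi'i'' x]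
  constructor <;> linarith [h11.1, h11.2, h112.1, h112.2]

/-- Class mass `[1,1,2]`: `(I(e_i + e_{i'}) + I(e_i + e_{i'} + 2e_{i''}))/2` as an enclosure from RATIONAL seed enclosures (`β = 0`, `ℚ`-cast form).
[cite: FitznerVanDerHofstad2016NoBLE, (3.34)–(3.35) p. 1071, §5.2 (5.9) p. 1092] -/
theorem srwTwist_cos_mul_cos_mul_cos_sq_zero_encl_cast {n : ℕ} (hd : 2 * n + 1 ≤ d) {i i' i'' : Fin d} (hii' : i ≠ i') (hii'' : i ≠ i'') (hi'i'' : i' ≠ i'') (x : Fin d → ℤ) {z₁₁ Z₁₁ z₁₁₂ Z₁₁₂ : ℚ}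
    (h11 : (z₁₁ : ℝ) ≤ srwI d n 0 (Pi.single i 1 + Pi.single i' 1) ∧ srwI d n 0 (Pi.single i 1 + Pi.single i' 1) ≤ (Z₁₁ : ℝ))
    (h112 : (z₁₁₂ : ℝ) ≤ srwI d n 0 (Pi.single i 1 + Pi.single i' 1 + Pi.single i'' 2) ∧ srwI d n 0 (Pi.single i 1 + Pi.single i' 1 + Pi.single i'' 2) ≤ (Z₁₁₂ : ℝ)) :
    (((z₁₁ + z₁₁₂) / 2 : ℚ) : ℝ) ≤ srwTwist d n (fun k => Real.cos (k i) * Real.cos (k i') * Real.cos (k i'') ^ 2) x 0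
      ∧ srwTwist d n (fun k => Real.cos (k i) * Real.cos (k i') * Real.cos (k i'') ^ 2) x 0 ≤ (((Z₁₁ + Z₁₁₂) / 2 : ℚ) : ℝ) := by
  push_cast
  exact srwTwist_cos_mul_cos_mul_cos_sq_zero_encl hd hii' hii'' hi'i'' x h11 h112

/-! ### The `∀ r`-hypotheses at the literal abscissae `gsetB = (5, 10, 15, 20, 25, 30)` -/

/-- The abscissae of the global coefficient set are `gsetB r = 5(r+1)`, i.e. `5, 10, 15, 20, 25, 30`.
[cite: FitznerVanDerHofstad2016NoBLE, §5.1.2 (5.11) p. 1091] -/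
theorem gsetB_eq : gsetB = fun r : Fin 6 => (5 : ℝ) * ((r : ℕ) + 1) := by
  funext r
  fin_cases r <;> simp [gsetB, MajCert.gset] <;> norm_num

/-- Assemble the `∀ r`-hypothesis of the `gset` rows (`srw{K,U,KM2}_le_gset_encl_cast` and the class rows
below) from six rational enclosures of `F` at the literal abscissae `β = 5, 10, 15, 20, 25, 30`; `F` is found
by unification (e.g. `F = srwTwist d n w x`), the bound vectors are `![a₀, …, a₅]`, `![b₀, …, b₅]`.
[cite: FitznerVanDerHofstad2016NoBLE, §5.1.2 (5.11) p. 1091] -/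
theorem encl_forall_gsetB {F : ℝ → ℝ} {a₀ a₁ a₂ a₃ a₄ a₅ b₀ b₁ b₂ b₃ b₄ b₅ : ℚ}
    (e0 : (a₀ : ℝ) ≤ F 5 ∧ F 5 ≤ (b₀ : ℝ)) (e1 : (a₁ : ℝ) ≤ F 10 ∧ F 10 ≤ (b₁ : ℝ))
    (e2 : (a₂ : ℝ) ≤ F 15 ∧ F 15 ≤ (b₂ : ℝ)) (e3 : (a₃ : ℝ) ≤ F 20 ∧ F 20 ≤ (b₃ : ℝ))
    (e4 : (a₄ : ℝ) ≤ F 25 ∧ F 25 ≤ (b₄ : ℝ)) (e5 : (a₅ : ℝ) ≤ F 30 ∧ F 30 ≤ (b₅ : ℝ)) :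
    ∀ r : Fin 6, ((![a₀, a₁, a₂, a₃, a₄, a₅] r : ℚ) : ℝ) ≤ F (gsetB r)
      ∧ F (gsetB r) ≤ ((![b₀, b₁, b₂, b₃, b₄, b₅] r : ℚ) : ℝ) := by
  intro r
  fin_cases r
  · simpa [gsetB, MajCert.gset] using e0
  · simpa [gsetB, MajCert.gset] using e1
  · simpa [gsetB, MajCert.gset] using e2
  · simpa [gsetB, MajCert.gset] using e3
  · simpa [gsetB, MajCert.gset] using e4
  · simpa [gsetB, MajCert.gset] using e5

/-! ### The assembled rows (literal coefficients `gset`, rational class enclosures) -/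

/-- **`K_{n,2}(x)` from pure-class enclosures** (classes `[2] = cos² k_i`, `[1,1] = cos k_i cos k_{i'}`,
`i ≠ i'`, `d ≥ 2n+1`): with rational enclosures `[T₂, T₂']`, `[T₁₁, T₁₁']` of the two class moments at
`β = 0`, `[l· r, h· r]` at the abscissae `gsetB r`, and `Sq^{|D̂|²}_n(x) ≤ Shi`,
`K_{n,2}(x) ≤ max(B·Tlo, B·Thi) + c·Shi + Σ_r max(a_r lo_r, a_r hi_r)` with
`Tlo = d⁻¹T₂ + ((d−1)/d)T₁₁`, `lo_r = d⁻¹ l₂ r + ((d−1)/d) l₁₁ r` (and primed / `h` for the upper ends).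
[cite: FitznerVanDerHofstad2016NoBLE, (3.36) p. 1071, §5.1.2 (5.11)–(5.16) pp. 1091–1092, §5.2 (5.9) p. 1092] -/
theorem srwK_two_le_gset_classEncl_cast {n : ℕ} (hd : 2 * n + 1 ≤ d) {i i' : Fin d} (hii' : i ≠ i')
    (x : Fin d → ℤ) {T₂ T₂' T₁₁ T₁₁' Shi : ℚ} {l₂ h₂ l₁₁ h₁₁ : Fin 6 → ℚ}
    (hT2 : (T₂ : ℝ) ≤ srwTwist d n (fun k => Real.cos (k i) ^ 2) x 0
      ∧ srwTwist d n (fun k => Real.cos (k i) ^ 2) x 0 ≤ (T₂' : ℝ))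
    (hT11 : (T₁₁ : ℝ) ≤ srwTwist d n (fun k => Real.cos (k i) * Real.cos (k i')) x 0
      ∧ srwTwist d n (fun k => Real.cos (k i) * Real.cos (k i')) x 0 ≤ (T₁₁' : ℝ))
    (hS : srwSqMom d n (fun k => |Dhat d k| ^ 2) x ≤ (Shi : ℝ))
    (h2 : ∀ r, (l₂ r : ℝ) ≤ srwTwist d n (fun k => Real.cos (k i) ^ 2) x (gsetB r)
      ∧ srwTwist d n (fun k => Real.cos (k i) ^ 2) x (gsetB r) ≤ (h₂ r : ℝ))
    (h11 : ∀ r, (l₁₁ r : ℝ) ≤ srwTwist d n (fun k => Real.cos (k i) * Real.cos (k i')) x (gsetB r)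
      ∧ srwTwist d n (fun k => Real.cos (k i) * Real.cos (k i')) x (gsetB r) ≤ (h₁₁ r : ℝ)) :
    srwK d n 2 x ≤ ((max (MajCert.gset.B * (1 / d * T₂ + ((d : ℚ) - 1) / d * T₁₁))
          (MajCert.gset.B * (1 / d * T₂' + ((d : ℚ) - 1) / d * T₁₁'))
        + MajCert.gset.c * Shi
        + ∑ r : Fin 6, max (MajCert.gset.a r * (1 / d * l₂ r + ((d : ℚ) - 1) / d * l₁₁ r))
            (MajCert.gset.a r * (1 / d * h₂ r + ((d : ℚ) - 1) / d * h₁₁ r)) : ℚ) : ℝ) := by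
  have hT : ((1 / d * T₂ + ((d : ℚ) - 1) / d * T₁₁ : ℚ) : ℝ)
        ≤ srwTwist d n (fun k => |Dhat d k| ^ 2) x 0
      ∧ srwTwist d n (fun k => |Dhat d k| ^ 2) x 0
        ≤ ((1 / d * T₂' + ((d : ℚ) - 1) / d * T₁₁' : ℚ) : ℝ) := by
    push_cast
    exact srwTwist_abs_Dhat_sq_encl hd hii' x 0 hT2 hT11
  have hr : ∀ r : Fin 6, ((1 / d * l₂ r + ((d : ℚ) - 1) / d * l₁₁ r : ℚ) : ℝ)
        ≤ srwTwist d n (fun k => |Dhat d k| ^ 2) x (gsetB r)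
      ∧ srwTwist d n (fun k => |Dhat d k| ^ 2) x (gsetB r)
        ≤ ((1 / d * h₂ r + ((d : ℚ) - 1) / d * h₁₁ r : ℚ) : ℝ) := fun r => by
    push_cast
    exact srwTwist_abs_Dhat_sq_encl hd hii' x (gsetB r) (h2 r) (h11 r)
  exact srwK_le_gset_encl_cast hd 2 x hT hS hr

/-- **`U_{n,0}(x)` from pure-class enclosures** (classes `[0] = 1`, `[2] = cos² k_i`, `d ≥ 2n+1`):
`Tlo = d⁻¹(T₀ − T₂')`, `Thi = d⁻¹(T₀' − T₂)`, `lo_r = d⁻¹(l₀ r − h₂ r)`, `hi_r = d⁻¹(h₀ r − l₂ r)`.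
[cite: FitznerVanDerHofstad2016NoBLE, (3.38) p. 1071, §5.1.2 (5.11)–(5.16) pp. 1091–1092, §5.2 (5.14) p. 1092] -/
theorem srwU_zero_le_gset_classEncl_cast {n : ℕ} (hd : 2 * n + 1 ≤ d) (i : Fin d) (x : Fin d → ℤ)
    {T₀ T₀' T₂ T₂' Shi : ℚ} {l₀ h₀ l₂ h₂ : Fin 6 → ℚ}
    (hT0 : (T₀ : ℝ) ≤ srwTwist d n (fun _ => (1 : ℝ)) x 0 ∧ srwTwist d n (fun _ => (1 : ℝ)) x 0 ≤ (T₀' : ℝ))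
    (hT2 : (T₂ : ℝ) ≤ srwTwist d n (fun k => Real.cos (k i) ^ 2) x 0
      ∧ srwTwist d n (fun k => Real.cos (k i) ^ 2) x 0 ≤ (T₂' : ℝ))
    (hS : srwSqMom d n (fun k => |Dhat d k| ^ 0 * Dsin d k) x ≤ (Shi : ℝ))
    (h0 : ∀ r, (l₀ r : ℝ) ≤ srwTwist d n (fun _ => (1 : ℝ)) x (gsetB r)
      ∧ srwTwist d n (fun _ => (1 : ℝ)) x (gsetB r) ≤ (h₀ r : ℝ))
    (h2 : ∀ r, (l₂ r : ℝ) ≤ srwTwist d n (fun k => Real.cos (k i) ^ 2) x (gsetB r)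
      ∧ srwTwist d n (fun k => Real.cos (k i) ^ 2) x (gsetB r) ≤ (h₂ r : ℝ)) :
    srwU d n 0 x ≤ ((max (MajCert.gset.B * (1 / d * (T₀ - T₂'))) (MajCert.gset.B * (1 / d * (T₀' - T₂)))
        + MajCert.gset.c * Shi
        + ∑ r : Fin 6, max (MajCert.gset.a r * (1 / d * (l₀ r - h₂ r)))
            (MajCert.gset.a r * (1 / d * (h₀ r - l₂ r))) : ℚ) : ℝ) := by
  have hT : ((1 / d * (T₀ - T₂') : ℚ) : ℝ) ≤ srwTwist d n (fun k => |Dhat d k| ^ 0 * Dsin d k) x 0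
      ∧ srwTwist d n (fun k => |Dhat d k| ^ 0 * Dsin d k) x 0 ≤ ((1 / d * (T₀' - T₂) : ℚ) : ℝ) := by
    push_cast
    exact srwTwist_abs_Dhat_pow_zero_mul_Dsin_encl hd i x 0 hT0 hT2
  have hr : ∀ r : Fin 6, ((1 / d * (l₀ r - h₂ r) : ℚ) : ℝ)
        ≤ srwTwist d n (fun k => |Dhat d k| ^ 0 * Dsin d k) x (gsetB r)
      ∧ srwTwist d n (fun k => |Dhat d k| ^ 0 * Dsin d k) x (gsetB r)
        ≤ ((1 / d * (h₀ r - l₂ r) : ℚ) : ℝ) := fun r => by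
    push_cast
    exact srwTwist_abs_Dhat_pow_zero_mul_Dsin_encl hd i x (gsetB r) (h0 r) (h2 r)
  exact srwU_le_gset_encl_cast hd 0 x hT hS hr

/-- **`U_{n,2}(x)` from pure-class enclosures** (`i₀, i, i'` pairwise distinct, `d ≥ 2n+1`; classes and
representatives as in `srwTwist_abs_Dhat_sq_mul_Dsin_eq_pure`: `[2] = cos² k_{i₀}`, `[4] = cos⁴ k_{i₀}`,
`[1,1] = cos k_{i₀} cos k_i`, `[2,2] = cos² k_{i₀} cos² k_i`, `[3,1] = cos³ k_{i₀} cos k_i`,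
`[1,1,2] = cos k_i cos k_{i'} cos² k_{i₀}`): at `β = 0` the enclosures `[T·, T·']`, at `gsetB r` the enclosures
`[l· r, h· r]`; the bound is the `U`-row with
`Tlo = d⁻¹(d⁻²((T₂ − T₄') + (d−1)(T₂ − T₂₂') + 2(d−1)(T₁₁ − T₃₁') + (d−1)(d−2)(T₁₁ − T₁₁₂')))` etc.
[cite: FitznerVanDerHofstad2016NoBLE, (3.38) p. 1071, §5.1.2 (5.11)–(5.16) pp. 1091–1092, §5.2 (5.14) p. 1092] -/
theorem srwU_two_le_gset_classEncl_cast {n : ℕ} (hd : 2 * n + 1 ≤ d) {i₀ i i' : Fin d}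
    (hi : i ≠ i₀) (hi' : i' ≠ i₀) (hii' : i ≠ i') (x : Fin d → ℤ)
    {T₂ T₂' T₄ T₄' T₁₁ T₁₁' T₂₂ T₂₂' T₃₁ T₃₁' T₁₁₂ T₁₁₂' Shi : ℚ}
    {l₂ h₂ l₄ h₄ l₁₁ h₁₁ l₂₂ h₂₂ l₃₁ h₃₁ l₁₁₂ h₁₁₂ : Fin 6 → ℚ}
    (hT2 : (T₂ : ℝ) ≤ srwTwist d n (fun k => Real.cos (k i₀) ^ 2) x 0
      ∧ srwTwist d n (fun k => Real.cos (k i₀) ^ 2) x 0 ≤ (T₂' : ℝ))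
    (hT4 : (T₄ : ℝ) ≤ srwTwist d n (fun k => Real.cos (k i₀) ^ 4) x 0
      ∧ srwTwist d n (fun k => Real.cos (k i₀) ^ 4) x 0 ≤ (T₄' : ℝ))
    (hT11 : (T₁₁ : ℝ) ≤ srwTwist d n (fun k => Real.cos (k i₀) * Real.cos (k i)) x 0
      ∧ srwTwist d n (fun k => Real.cos (k i₀) * Real.cos (k i)) x 0 ≤ (T₁₁' : ℝ))
    (hT22 : (T₂₂ : ℝ) ≤ srwTwist d n (fun k => Real.cos (k i₀) ^ 2 * Real.cos (k i) ^ 2) x 0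
      ∧ srwTwist d n (fun k => Real.cos (k i₀) ^ 2 * Real.cos (k i) ^ 2) x 0 ≤ (T₂₂' : ℝ))
    (hT31 : (T₃₁ : ℝ) ≤ srwTwist d n (fun k => Real.cos (k i₀) ^ 3 * Real.cos (k i)) x 0
      ∧ srwTwist d n (fun k => Real.cos (k i₀) ^ 3 * Real.cos (k i)) x 0 ≤ (T₃₁' : ℝ))
    (hT112 : (T₁₁₂ : ℝ)
        ≤ srwTwist d n (fun k => Real.cos (k i) * Real.cos (k i') * Real.cos (k i₀) ^ 2) x 0
      ∧ srwTwist d n (fun k => Real.cos (k i) * Real.cos (k i') * Real.cos (k i₀) ^ 2) x 0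
        ≤ (T₁₁₂' : ℝ))
    (hS : srwSqMom d n (fun k => |Dhat d k| ^ 2 * Dsin d k) x ≤ (Shi : ℝ))
    (h2 : ∀ r, (l₂ r : ℝ) ≤ srwTwist d n (fun k => Real.cos (k i₀) ^ 2) x (gsetB r)
      ∧ srwTwist d n (fun k => Real.cos (k i₀) ^ 2) x (gsetB r) ≤ (h₂ r : ℝ))
    (h4 : ∀ r, (l₄ r : ℝ) ≤ srwTwist d n (fun k => Real.cos (k i₀) ^ 4) x (gsetB r)
      ∧ srwTwist d n (fun k => Real.cos (k i₀) ^ 4) x (gsetB r) ≤ (h₄ r : ℝ))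
    (h11 : ∀ r, (l₁₁ r : ℝ) ≤ srwTwist d n (fun k => Real.cos (k i₀) * Real.cos (k i)) x (gsetB r)
      ∧ srwTwist d n (fun k => Real.cos (k i₀) * Real.cos (k i)) x (gsetB r) ≤ (h₁₁ r : ℝ))
    (h22 : ∀ r, (l₂₂ r : ℝ) ≤ srwTwist d n (fun k => Real.cos (k i₀) ^ 2 * Real.cos (k i) ^ 2) x (gsetB r)
      ∧ srwTwist d n (fun k => Real.cos (k i₀) ^ 2 * Real.cos (k i) ^ 2) x (gsetB r) ≤ (h₂₂ r : ℝ))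
    (h31 : ∀ r, (l₃₁ r : ℝ) ≤ srwTwist d n (fun k => Real.cos (k i₀) ^ 3 * Real.cos (k i)) x (gsetB r)
      ∧ srwTwist d n (fun k => Real.cos (k i₀) ^ 3 * Real.cos (k i)) x (gsetB r) ≤ (h₃₁ r : ℝ))
    (h112 : ∀ r, (l₁₁₂ r : ℝ)
        ≤ srwTwist d n (fun k => Real.cos (k i) * Real.cos (k i') * Real.cos (k i₀) ^ 2) x (gsetB r)
      ∧ srwTwist d n (fun k => Real.cos (k i) * Real.cos (k i') * Real.cos (k i₀) ^ 2) x (gsetB r)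
        ≤ (h₁₁₂ r : ℝ)) :
    srwU d n 2 x ≤ ((max
          (MajCert.gset.B * (1 / d * ((1 / (d : ℚ)) ^ 2 * ((T₂ - T₄') + ((d : ℚ) - 1) * (T₂ - T₂₂')
            + 2 * ((d : ℚ) - 1) * (T₁₁ - T₃₁') + ((d : ℚ) - 1) * ((d : ℚ) - 2) * (T₁₁ - T₁₁₂')))))
          (MajCert.gset.B * (1 / d * ((1 / (d : ℚ)) ^ 2 * ((T₂' - T₄) + ((d : ℚ) - 1) * (T₂' - T₂₂)
            + 2 * ((d : ℚ) - 1) * (T₁₁' - T₃₁) + ((d : ℚ) - 1) * ((d : ℚ) - 2) * (T₁₁' - T₁₁₂)))))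
        + MajCert.gset.c * Shi
        + ∑ r : Fin 6, max
          (MajCert.gset.a r * (1 / d * ((1 / (d : ℚ)) ^ 2 * ((l₂ r - h₄ r)
            + ((d : ℚ) - 1) * (l₂ r - h₂₂ r) + 2 * ((d : ℚ) - 1) * (l₁₁ r - h₃₁ r)
            + ((d : ℚ) - 1) * ((d : ℚ) - 2) * (l₁₁ r - h₁₁₂ r)))))
          (MajCert.gset.a r * (1 / d * ((1 / (d : ℚ)) ^ 2 * ((h₂ r - l₄ r)
            + ((d : ℚ) - 1) * (h₂ r - l₂₂ r) + 2 * ((d : ℚ) - 1) * (h₁₁ r - l₃₁ r)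
            + ((d : ℚ) - 1) * ((d : ℚ) - 2) * (h₁₁ r - l₁₁₂ r))))) : ℚ) : ℝ) := by
  have hT : ((1 / d * ((1 / (d : ℚ)) ^ 2 * ((T₂ - T₄') + ((d : ℚ) - 1) * (T₂ - T₂₂')
            + 2 * ((d : ℚ) - 1) * (T₁₁ - T₃₁') + ((d : ℚ) - 1) * ((d : ℚ) - 2) * (T₁₁ - T₁₁₂'))) : ℚ) : ℝ)
        ≤ srwTwist d n (fun k => |Dhat d k| ^ 2 * Dsin d k) x 0
      ∧ srwTwist d n (fun k => |Dhat d k| ^ 2 * Dsin d k) x 0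
        ≤ ((1 / d * ((1 / (d : ℚ)) ^ 2 * ((T₂' - T₄) + ((d : ℚ) - 1) * (T₂' - T₂₂)
            + 2 * ((d : ℚ) - 1) * (T₁₁' - T₃₁) + ((d : ℚ) - 1) * ((d : ℚ) - 2) * (T₁₁' - T₁₁₂))) : ℚ) : ℝ) := by
    push_cast
    exact srwTwist_abs_Dhat_sq_mul_Dsin_encl hd hi hi' hii' x 0 hT2 hT4 hT11 hT22 hT31 hT112
  have hr : ∀ r : Fin 6,
      ((1 / d * ((1 / (d : ℚ)) ^ 2 * ((l₂ r - h₄ r)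
            + ((d : ℚ) - 1) * (l₂ r - h₂₂ r) + 2 * ((d : ℚ) - 1) * (l₁₁ r - h₃₁ r)
            + ((d : ℚ) - 1) * ((d : ℚ) - 2) * (l₁₁ r - h₁₁₂ r))) : ℚ) : ℝ)
        ≤ srwTwist d n (fun k => |Dhat d k| ^ 2 * Dsin d k) x (gsetB r)
      ∧ srwTwist d n (fun k => |Dhat d k| ^ 2 * Dsin d k) x (gsetB r)
        ≤ ((1 / d * ((1 / (d : ℚ)) ^ 2 * ((h₂ r - l₄ r)
            + ((d : ℚ) - 1) * (h₂ r - l₂₂ r) + 2 * ((d : ℚ) - 1) * (h₁₁ r - l₃₁ r)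
            + ((d : ℚ) - 1) * ((d : ℚ) - 2) * (h₁₁ r - l₁₁₂ r))) : ℚ) : ℝ) := fun r => by
    push_cast
    exact srwTwist_abs_Dhat_sq_mul_Dsin_encl hd hi hi' hii' x (gsetB r) (h2 r) (h4 r) (h11 r) (h22 r)
      (h31 r) (h112 r)
  exact srwU_le_gset_encl_cast hd 2 x hT hS hr

/-- **`KM₂_{n,0}(x)` from pure-class enclosures** (`i ≠ i'`, `d ≥ 2(n+2)+1`; classes and representatives as in
`srwTwist_abs_Dhat_pow_zero_mul_Mhat_sq_eq_pure`, at the Schwinger orders `n` (`[2]`, `[1,1]`), `n+1`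
(`[1]`, `[3]`, `[1,2]`) and `n+2` (`[0]`, `[2]`, `[4]`, `[2,2]`)): at `β = 0` the enclosures `[T·, T·']`
(order `n`), `[V·, V·']` (order `n+1`), `[W·, W·']` (order `n+2`); at `gsetB r` the enclosures `[l· r, h· r]`,
`[p· r, q· r]`, `[u· r, v· r]` respectively; the bound is the `KM₂`-row with the pure-class lower / upper
combinations of `srwTwist_abs_Dhat_pow_zero_mul_Mhat_sq_encl`.
[cite: FitznerVanDerHofstad2016NoBLE, (3.36)–(3.38) p. 1071, §5.1.2 (5.11)–(5.16) pp. 1091–1092, §5.2 (5.9), (5.14) p. 1092] -/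
theorem srwKM2_zero_le_gset_classEncl_cast {n : ℕ} (hd : 2 * (n + 2) + 1 ≤ d) {i i' : Fin d}
    (hii' : i ≠ i') (x : Fin d → ℤ)
    {T₂ T₂' T₁₁ T₁₁' V₁ V₁' V₃ V₃' V₁₂ V₁₂' W₀ W₀' W₂ W₂' W₄ W₄' W₂₂ W₂₂' Shi : ℚ}
    {l₂ h₂ l₁₁ h₁₁ p₁ q₁ p₃ q₃ p₁₂ q₁₂ u₀ v₀ u₂ v₂ u₄ v₄ u₂₂ v₂₂ : Fin 6 → ℚ}
    (hT2 : (T₂ : ℝ) ≤ srwTwist d n (fun k => Real.cos (k i) ^ 2) x 0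
      ∧ srwTwist d n (fun k => Real.cos (k i) ^ 2) x 0 ≤ (T₂' : ℝ))
    (hT11 : (T₁₁ : ℝ) ≤ srwTwist d n (fun k => Real.cos (k i) * Real.cos (k i')) x 0
      ∧ srwTwist d n (fun k => Real.cos (k i) * Real.cos (k i')) x 0 ≤ (T₁₁' : ℝ))
    (hV1 : (V₁ : ℝ) ≤ srwTwist d (n + 1) (fun k => Real.cos (k i)) x 0
      ∧ srwTwist d (n + 1) (fun k => Real.cos (k i)) x 0 ≤ (V₁' : ℝ))
    (hV3 : (V₃ : ℝ) ≤ srwTwist d (n + 1) (fun k => Real.cos (k i) ^ 3) x 0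
      ∧ srwTwist d (n + 1) (fun k => Real.cos (k i) ^ 3) x 0 ≤ (V₃' : ℝ))
    (hV12 : (V₁₂ : ℝ) ≤ srwTwist d (n + 1) (fun k => Real.cos (k i) * Real.cos (k i') ^ 2) x 0
      ∧ srwTwist d (n + 1) (fun k => Real.cos (k i) * Real.cos (k i') ^ 2) x 0 ≤ (V₁₂' : ℝ))
    (hW0 : (W₀ : ℝ) ≤ srwTwist d (n + 2) (fun _ => (1 : ℝ)) x 0
      ∧ srwTwist d (n + 2) (fun _ => (1 : ℝ)) x 0 ≤ (W₀' : ℝ))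
    (hW2 : (W₂ : ℝ) ≤ srwTwist d (n + 2) (fun k => Real.cos (k i) ^ 2) x 0
      ∧ srwTwist d (n + 2) (fun k => Real.cos (k i) ^ 2) x 0 ≤ (W₂' : ℝ))
    (hW4 : (W₄ : ℝ) ≤ srwTwist d (n + 2) (fun k => Real.cos (k i) ^ 4) x 0
      ∧ srwTwist d (n + 2) (fun k => Real.cos (k i) ^ 4) x 0 ≤ (W₄' : ℝ))
    (hW22 : (W₂₂ : ℝ) ≤ srwTwist d (n + 2) (fun k => Real.cos (k i) ^ 2 * Real.cos (k i') ^ 2) x 0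
      ∧ srwTwist d (n + 2) (fun k => Real.cos (k i) ^ 2 * Real.cos (k i') ^ 2) x 0 ≤ (W₂₂' : ℝ))
    (hS : srwSqMom d n (fun k => |Dhat d k| ^ 0 * Mhat d k ^ 2) x ≤ (Shi : ℝ))
    (h2 : ∀ r, (l₂ r : ℝ) ≤ srwTwist d n (fun k => Real.cos (k i) ^ 2) x (gsetB r)
      ∧ srwTwist d n (fun k => Real.cos (k i) ^ 2) x (gsetB r) ≤ (h₂ r : ℝ))
    (h11 : ∀ r, (l₁₁ r : ℝ) ≤ srwTwist d n (fun k => Real.cos (k i) * Real.cos (k i')) x (gsetB r)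
      ∧ srwTwist d n (fun k => Real.cos (k i) * Real.cos (k i')) x (gsetB r) ≤ (h₁₁ r : ℝ))
    (g1 : ∀ r, (p₁ r : ℝ) ≤ srwTwist d (n + 1) (fun k => Real.cos (k i)) x (gsetB r)
      ∧ srwTwist d (n + 1) (fun k => Real.cos (k i)) x (gsetB r) ≤ (q₁ r : ℝ))
    (g3 : ∀ r, (p₃ r : ℝ) ≤ srwTwist d (n + 1) (fun k => Real.cos (k i) ^ 3) x (gsetB r)
      ∧ srwTwist d (n + 1) (fun k => Real.cos (k i) ^ 3) x (gsetB r) ≤ (q₃ r : ℝ))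
    (g12 : ∀ r, (p₁₂ r : ℝ) ≤ srwTwist d (n + 1) (fun k => Real.cos (k i) * Real.cos (k i') ^ 2) x (gsetB r)
      ∧ srwTwist d (n + 1) (fun k => Real.cos (k i) * Real.cos (k i') ^ 2) x (gsetB r) ≤ (q₁₂ r : ℝ))
    (f0 : ∀ r, (u₀ r : ℝ) ≤ srwTwist d (n + 2) (fun _ => (1 : ℝ)) x (gsetB r)
      ∧ srwTwist d (n + 2) (fun _ => (1 : ℝ)) x (gsetB r) ≤ (v₀ r : ℝ))
    (f2 : ∀ r, (u₂ r : ℝ) ≤ srwTwist d (n + 2) (fun k => Real.cos (k i) ^ 2) x (gsetB r)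
      ∧ srwTwist d (n + 2) (fun k => Real.cos (k i) ^ 2) x (gsetB r) ≤ (v₂ r : ℝ))
    (f4 : ∀ r, (u₄ r : ℝ) ≤ srwTwist d (n + 2) (fun k => Real.cos (k i) ^ 4) x (gsetB r)
      ∧ srwTwist d (n + 2) (fun k => Real.cos (k i) ^ 4) x (gsetB r) ≤ (v₄ r : ℝ))
    (f22 : ∀ r, (u₂₂ r : ℝ) ≤ srwTwist d (n + 2) (fun k => Real.cos (k i) ^ 2 * Real.cos (k i') ^ 2) x (gsetB r)
      ∧ srwTwist d (n + 2) (fun k => Real.cos (k i) ^ 2 * Real.cos (k i') ^ 2) x (gsetB r) ≤ (v₂₂ r : ℝ)) :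
    srwKM2 d n 0 x ≤ ((max
          (MajCert.gset.B * ((1 / d * T₂ + ((d : ℚ) - 1) / d * T₁₁)
            - 4 * ((1 / (d : ℚ)) ^ 2 * ((V₁' - V₃) + ((d : ℚ) - 1) * (V₁' - V₁₂)))
            + 4 * ((1 / (d : ℚ)) ^ 3 * (((W₀ - W₂') - (W₂' - W₄)) + ((d : ℚ) - 1) * ((W₀ - W₂') - (W₂' - W₂₂))))))
          (MajCert.gset.B * ((1 / d * T₂' + ((d : ℚ) - 1) / d * T₁₁')
            - 4 * ((1 / (d : ℚ)) ^ 2 * ((V₁ - V₃') + ((d : ℚ) - 1) * (V₁ - V₁₂')))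
            + 4 * ((1 / (d : ℚ)) ^ 3 * (((W₀' - W₂) - (W₂ - W₄')) + ((d : ℚ) - 1) * ((W₀' - W₂) - (W₂ - W₂₂'))))))
        + MajCert.gset.c * Shi
        + ∑ r : Fin 6, max
          (MajCert.gset.a r * ((1 / d * l₂ r + ((d : ℚ) - 1) / d * l₁₁ r)
            - 4 * ((1 / (d : ℚ)) ^ 2 * ((q₁ r - p₃ r) + ((d : ℚ) - 1) * (q₁ r - p₁₂ r)))
            + 4 * ((1 / (d : ℚ)) ^ 3 * (((u₀ r - v₂ r) - (v₂ r - u₄ r))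
              + ((d : ℚ) - 1) * ((u₀ r - v₂ r) - (v₂ r - u₂₂ r))))))
          (MajCert.gset.a r * ((1 / d * h₂ r + ((d : ℚ) - 1) / d * h₁₁ r)
            - 4 * ((1 / (d : ℚ)) ^ 2 * ((p₁ r - q₃ r) + ((d : ℚ) - 1) * (p₁ r - q₁₂ r)))
            + 4 * ((1 / (d : ℚ)) ^ 3 * (((v₀ r - u₂ r) - (u₂ r - v₄ r))
              + ((d : ℚ) - 1) * ((v₀ r - u₂ r) - (u₂ r - v₂₂ r)))))) : ℚ) : ℝ) := by
  have hd0 : 2 * n + 1 ≤ d := by omega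
  have hT : ((((1 / d * T₂ + ((d : ℚ) - 1) / d * T₁₁)
            - 4 * ((1 / (d : ℚ)) ^ 2 * ((V₁' - V₃) + ((d : ℚ) - 1) * (V₁' - V₁₂)))
            + 4 * ((1 / (d : ℚ)) ^ 3 * (((W₀ - W₂') - (W₂' - W₄))
              + ((d : ℚ) - 1) * ((W₀ - W₂') - (W₂' - W₂₂))))) : ℚ) : ℝ)
        ≤ srwTwist d n (fun k => |Dhat d k| ^ 0 * Mhat d k ^ 2) x 0
      ∧ srwTwist d n (fun k => |Dhat d k| ^ 0 * Mhat d k ^ 2) x 0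
        ≤ ((((1 / d * T₂' + ((d : ℚ) - 1) / d * T₁₁')
            - 4 * ((1 / (d : ℚ)) ^ 2 * ((V₁ - V₃') + ((d : ℚ) - 1) * (V₁ - V₁₂')))
            + 4 * ((1 / (d : ℚ)) ^ 3 * (((W₀' - W₂) - (W₂ - W₄'))
              + ((d : ℚ) - 1) * ((W₀' - W₂) - (W₂ - W₂₂'))))) : ℚ) : ℝ) := by
    push_cast
    exact srwTwist_abs_Dhat_pow_zero_mul_Mhat_sq_encl hd hii' x 0 hT2 hT11 hV1 hV3 hV12 hW0 hW2 hW4 hW22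
  have hr : ∀ r : Fin 6,
      ((((1 / d * l₂ r + ((d : ℚ) - 1) / d * l₁₁ r)
            - 4 * ((1 / (d : ℚ)) ^ 2 * ((q₁ r - p₃ r) + ((d : ℚ) - 1) * (q₁ r - p₁₂ r)))
            + 4 * ((1 / (d : ℚ)) ^ 3 * (((u₀ r - v₂ r) - (v₂ r - u₄ r))
              + ((d : ℚ) - 1) * ((u₀ r - v₂ r) - (v₂ r - u₂₂ r))))) : ℚ) : ℝ)
        ≤ srwTwist d n (fun k => |Dhat d k| ^ 0 * Mhat d k ^ 2) x (gsetB r)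
      ∧ srwTwist d n (fun k => |Dhat d k| ^ 0 * Mhat d k ^ 2) x (gsetB r)
        ≤ ((((1 / d * h₂ r + ((d : ℚ) - 1) / d * h₁₁ r)
            - 4 * ((1 / (d : ℚ)) ^ 2 * ((p₁ r - q₃ r) + ((d : ℚ) - 1) * (p₁ r - q₁₂ r)))
            + 4 * ((1 / (d : ℚ)) ^ 3 * (((v₀ r - u₂ r) - (u₂ r - v₄ r))
              + ((d : ℚ) - 1) * ((v₀ r - u₂ r) - (u₂ r - v₂₂ r))))) : ℚ) : ℝ) := fun r => by
    push_cast
    exact srwTwist_abs_Dhat_pow_zero_mul_Mhat_sq_encl hd hii' x (gsetB r) (h2 r) (h11 r) (g1 r) (g3 r)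
      (g12 r) (f0 r) (f2 r) (f4 r) (f22 r)
  exact srwKM2_le_gset_encl_cast hd0 0 x hT hS hr

end Literature.Probability.FitznerVanDerHofstad2017

end
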